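import Summits.HodgeConjecture.HodgeConjecture.Theses.RankFourFaces
import Summits.HodgeConjecture.HodgeConjecture.Theorems.AnchorTransportVariationalHodgeReductions
import Summits.HodgeConjecture.HodgeConjecture.Theorems.AnchorTransportVariationalHodgeClosing
import Summits.HodgeConjecture.HodgeConjecture.Theorems.AnchorTransportVariationalHodgeDominance
import Summits.HodgeConjecture.HodgeConjecture.Theorems.AnchorTransportVariationalHodgeQuasiProjective
import Summits.HodgeConjecture.HodgeConjecture.Theorems.AnchorTransportVariationalHodgeSemiregular
import Literature.AlgebraicGeometry.HodgeTheory.AlgebraicityLocusIUnionClosedProofs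
import Literature.AlgebraicGeometry.HodgeTheory.AlgebraicClassesHodgeTypeHolds
import Literature.AlgebraicGeometry.HodgeTheory.HodgeTypeConjugation
import Literature.AlgebraicGeometry.HodgeTheory.QuasiProjectiveOfAffine
import Literature.AlgebraicGeometry.HodgeTheory.StandardChernCharacterBetti

/-!
# Line `sr-socket` — crux `RankFourWeilTransport` (stmt-HodgeConjecture-16265), route `RankFourFaces`

STRATEGIST LINE (planner-cstrat-stmt-HodgeConjecture-16265-s1-0, 2026-08-17), an ALTERNATIVE to the
birth skeleton `Lines/birth.lean` (never overwritten). Birth cuts the crux as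
`LocallyProjective → LocalTransport → crux`, where `LocalTransport` (S2) is the local variational Hodge
statement itself — engine-agnostic, with no attack surface short of the Hodge conjecture ("dies only
with HC", registrar; "S2 ≡ crux modulo S1 and landed closing theorems", skeleton-vet advisory).

This line COMMITS TO THE ONE KNOWN GENERAL ENGINE in codimension two — Buchweitz–Flenner's
semiregularity theorem for SHEAVES with partial Chern character `I = {1, 2}` (Compositio 2003,
Thm. 5.1), whose socket the tree already carries and globalises
(`Theorems.variationalHodge_conclusion_two_of_semiregular`: a `{0,1}`-semiregular finite locally free
`ℰ₀` on the anchor fibre whose `ch₁`, `ch₂` are restrictions of global classes of fibrewise Hodge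
type `(1,1)`, `(2,2)` makes `ch₂` algebraic on EVERY fibre, over a smooth irreducible quasi-projective
base with quasi-projective total space, granted the BF fact and the DISCHARGED Hilbert-scheme fact) —
and moves the whole open content of the crux into ONE POINTWISE SHEAF-EXISTENCE statement at the
anchor fibre, `SemiregularSeed` (S3): the algebraic anchor class `W|_{𝒳_{s₀}}` is, up to a
DECOMPOSABLE correction (a combination of products of two global classes with fibrewise algebraic
divisor restrictions — so that an exceptional `W` cannot be absorbed into the correction: the
statement is NOT the crux reworded), the second Chern character of a `{0,1}`-semiregular vector
bundle whose first Chern character extends to a global fibrewise-`(1,1)` class.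

Why the `I = {1,2}` form matters (and why this is not the registrar's rejected "seed" cut). BF with
`I = {1,2}` needs only `ch₁`, `ch₂` of `ℰ₀` to stay of Hodge type along the family — NOT the whole
Chern character — and `{0,1}`-semiregularity is injectivity of `(Tr, Tr(At ∘ ·))` on `Ext²(ℰ₀, ℰ₀)`
only. This makes cheap candidates computable: e.g. `ℰ₀ = 𝓛₁ ⊕ 𝓛₂` on an abelian `4g`-fold is
`{0,1}`-semiregular iff `𝓛₁ ⊗ 𝓛₂⁻¹` is non-degenerate of index `∉ {2, 4g − 2}` (Mumford's index
theorem kills the off-diagonal `Ext²`, hard Lefschetz makes `a ↦ a ∪ c₁(𝓛₁ ⊗ 𝓛₂⁻¹)` injective on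
`H^{0,2}`), so INDEFINITE seeds exist exactly when `g ≥ 2` — the route's range. The strategist's
census (`STRATEGY-CENSUS.md`, §Negation) records the first no-go in this language: for every abelian
variety of the sector and every `ℰ₀ = 𝓛₁ ⊕ 𝓛₂`, if `ch₁(ℰ₀)`, `ch₂(ℰ₀)` are invariant under the generic
Mumford–Tate group of the rank-four family then the `E`-Weil component of `ch₂(ℰ₀)` vanishes (a
rank/decomposability clash in `⋀²V_σ ⊗ ⋀²V_σ̄`: `⋀²h + 2 x ⊗ x̄♭ = λ·id` forces the bivector `x` to be
decomposable). So split seeds of rank `≤ 2` are dead at EVERY point; rank `≥ 3` split seeds,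
Fourier–Mukai transforms of sheaves on special subvarieties (Markman's secant sheaves on `Y × Ŷ`,
`Y` with real multiplication by `E⁺`, arXiv:2509.23403 §§4–5) and seeds at richer anchors (Schoen's
Prym loci, CM points) are the live constructions S3 asks for. Either outcome of such a computation is
informative, which is what birth's S2 lacks.

## The cut (four named stubs, composed by `RankFourWeilTransport_of`)

* `stub_locallyProjective` (S1, the SAME statement as birth's S1 — shared on purpose: whoever proves
  it serves both lines): abelian-fibred smooth projective families are Zariski-locally of
  quasi-projective total space. Theorem-to-prove, size M/L (sketch in `Lines/birth.lean`).
* `stub_buchweitzFlenner` (S2', a PUBLISHED THEOREM kept in the tree as the named fact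
  `BuchweitzFlenner2003_variationalHodge_semiregular`, BF 2003 Thm. 5.1 with `I = {1,2}`; the tree
  proves its last step, `SemiregularVariationalHodge.lean`): size L/XL (obstruction theory of BF §3,
  Prop. 5.9 / Lemma 5.10, versality, Artin approximation on the tree's carriers).
* `stub_semiregularSeed` (S3, THE BET): for the crux's families with quasi-projective total space
  over a smooth irreducible AFFINE base and an anchor `s₀`, a `{0,1}`-semiregular finite locally free
  `ℰ₀` on `𝒳_{s₀}` with `ch₁(ℰ₀) = A₁|_{𝒳_{s₀}}` (`A₁` global, fibrewise `(1,1)`) and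
  `ch₂(ℰ₀) = W|_{𝒳_{s₀}} + B|_{𝒳_{s₀}}`, `B` a global class with fibrewise ALGEBRAIC restrictions lying
  in the span of cup products of pairs of global classes with fibrewise algebraic divisor
  restrictions (decomposable correction).
* `stub_chernCharacter` (S4, CONSTRUCTION, size L, formal): `Nonempty StandardChernCharacterBetti` — the
  standard Chern character theory on the tree's carriers, in which S3 is stated (D-0014 idiom: the seed
  is stated for every standard theory, the engine S2' for every theory; S4 supplies one); shared by name
  with `quaternionic-norm-anchors` (crux `WeilTenfoldsSqrtMinus11`).

`RankFourWeilTransport_of : S1 → S2' → S3 → S4 → RankFourWeilTransport` is PROVED below (no `sorry`):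
chain `s₀ → u → s` through two S1-opens (irreducibility + Jacobson), restrict the family to each
affine open (`Motives.familyPullback`; fibres, `E`-structures, the class, its Hodge data and the
anchor moved across `fiberOverFamilyPullbackIso`, exactly as in birth), take the seed of S3 on the
restricted family, feed `A₂ := W' + B` to the tree's
`variationalHodge_conclusion_two_of_semiregular` (BF from S2', the discharged
`charlesSchnell_algebraicityLocus_iUnion_closed_holds`, the relative dimension of the affine base from
`exists_smoothOfRelativeDimension_of_connectedSpace_complexPoints` + SGA1 XII 2.4), and subtract the
algebraic `B|_{𝒳_t}`.

## Honesty box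

* WHERE THE DIFFICULTY SITS. S3 carries the open content; S1 is provable, S2' is a published theorem.
  S3 is NOT sandwiched by the Hodge conjecture the way birth's S2 is: HC gives CYCLES on every fibre,
  not a semiregular bundle at the anchor whose `ch₂` meets `W` modulo decomposables — so S3 can be
  FALSE while the crux is true (the bet: Voisin, "general principles do not give semiregular
  representatives"), and it can be attacked/refuted pointwise by sheaf constructions and finite
  linear algebra. If the correction `B` were allowed to be ANY fibrewise-algebraic global class, S3
  would be implied by the crux's conclusion (`ℰ₀ = 𝒪`, `B = −W`) and the line would be costume; the
  decomposability clause is exactly what prevents this, and the glue never uses it (it uses only the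
  algebraicity of `B|_{𝒳_t}`, which on abelian fibres follows from decomposability by Kleiman's
  translation argument, `AbelianVariety.cupProduct_mem_algebraicClasses_one`).
* NO STUB IS THE CRUX OR THE SUMMIT IN COSTUME: S1, S2' as in birth / literature; S3 concludes the
  existence of a sheaf on ONE fibre, not algebraicity anywhere; `S3 → crux` needs S2' + S1 + the
  1 600-line locus theorem + Baire, all consumed below.
* Disproof used: `Cruxes/RankFourWeilTransport/` has no `Disproof.lean`; the sibling disproof
  (`Cruxes/VariationalHodge/Disproof.lean`: the anchor carries everything) is honoured — S3 is a
  statement AT the anchor and uses its algebraicity (`W|_{𝒳_{s₀}}` algebraic is a hypothesis of S3).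
  2001 barrier B2 ("first-order semiregularity does not propagate", Markman Q11.4 NO): not needed —
  semiregularity is used ONCE, at the anchor; the spread is closed by Baire + Hilbert schemes, never
  by re-seeding. `ledger negatives --problem HodgeConjecture`: nothing of the shape of S3.
-/

set_option linter.dupNamespace false

noncomputable section

open CategoryTheory AlgebraicGeometry TopologicalSpace
open Literature.AlgebraicTopology.SingularHomology
open Literature.AlgebraicGeometry.Motives Literature.AlgebraicGeometry.HodgeTheory
open Summit.HodgeConjecture.HodgeConjecture.Theses.RankFourFaces
open Summit.HodgeConjecture.HodgeConjecture.Theorems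

namespace Summit.HodgeConjecture.HodgeConjecture.Cruxes.RankFourWeilTransport.SrSocket

/-! ## §1 Statements of the stubs -/

/-- Statement of STUB S1 (shared verbatim with `Lines/birth.lean`) — **abelian-fibred smooth
projective families are Zariski-locally quasi-projective**: for `f : 𝒳 ⟶ S` a smooth projective
family of relative dimension `n` over `S` smooth over `ℂ` whose complex fibres are underlying varieties
of abelian varieties, every complex point `s` lies in an affine open `U` with `𝒳 ×_S U` quasi-projective
over `ℂ`. Why plausibly true: generic fibre projective, an ample divisor extends near `s`, its `c₁` is
flat and positive semi-definite non-degenerate on the torus `𝒳_s`, hence ample, so `f` is projective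
over an affine neighbourhood (EGA III 4.7.1). False for non-abelian fibres (Atiyah flops), which is why
the fibre hypothesis is kept. -/
def LocallyProjective : Prop :=
  ∀ (n : ℕ) ⦃𝒳 S : SchemeOver ℂ⦄ (f : 𝒳 ⟶ S), IsSmoothProjectiveFamily f n →
    AlgebraicGeometry.Smooth S.hom →
    (∀ s : ComplexPoints S, ∃ A' : AbelianVariety ℂ, Nonempty (A'.X ≅ fiberOver f s)) →
    ∀ s : ComplexPoints S, ∃ U : S.left.Opens, IsAffineOpen U ∧ s.pt ∈ U ∧
      IsQuasiProjectiveOver (familyPullback f (openSubschemeOverι S U))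

/-- Statement of STUB S3 — **SEMIREGULAR SEEDS AT THE ANCHOR** (the bet). Data: a Chern character
theory `C` (hypothesis structure `ChernCharacterBetti`); the crux's arithmetic data (`g ≥ 2`, `P`); a
smooth projective family `f : 𝒳 ⟶ S` of relative dimension `4g` with QUASI-PROJECTIVE total space over
a smooth irreducible AFFINE base, all complex fibres `≅ (A', φ')` with `A'.dim = 4g`, `P(φ') = 0`; a
global class `W ∈ H⁴(𝒳(ℂ); ℂ)` with rational `(2,2)` fibre restrictions; an anchor `s₀` where
`W|_{𝒳_{s₀}}` is algebraic. Conclusion: there are a global class `A₁ ∈ H²(𝒳(ℂ); ℂ)` with fibre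
restrictions of type `(1,1)`, a global class `B ∈ H⁴(𝒳(ℂ); ℂ)` which is DECOMPOSABLE — in the `ℂ`-span
of the cup products `D ∪ D'` of pairs of global degree-`2` classes all of whose fibre restrictions are
algebraic divisor classes — and has algebraic fibre restrictions, and a finite locally free
`{0,1}`-semiregular `ℰ₀` on `𝒳_{s₀}` with `ch₁(ℰ₀) = A₁|_{𝒳_{s₀}}` and
`ch₂(ℰ₀) = W|_{𝒳_{s₀}} + B|_{𝒳_{s₀}}`. Why plausibly true / the bet: `{0,1}`-semiregular bundles with
prescribed `(ch₁, ch₂)` modulo decomposables are what Markman-type secant/Fourier–Mukai sheaves should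
supply in rank four (arXiv:2509.23403 §§4–5, §12); split bundles of rank `≤ 2` provably cannot (census,
§Negation), rank `≥ 3` and non-split candidates are computable case by case. Why it might fail:
semiregular representatives of exceptional classes may simply not exist on abelian `4g`-folds (no
general principle produces them — Voisin); the statement is stronger than the crux in a skew
direction (not implied by HC). -/
def SemiregularSeed : Prop :=
  ∀ (C : StandardChernCharacterBetti) (g : ℕ), 2 ≤ g → ∀ (P : Polynomial ℤ), P.Monic → P.natDegree = 2 * g →
    Irreducible (P.map (Int.castRingHom ℚ)) →
    (∀ ρ : ℂ, Polynomial.eval₂ (Int.castRingHom ℂ) ρ P = 0 → ρ.im ≠ 0) →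
    (∃ Q : Polynomial ℚ, ∀ ρ : ℂ, Polynomial.eval₂ (Int.castRingHom ℂ) ρ P = 0 →
      Polynomial.aeval ρ Q = (starRingEnd ℂ) ρ) →
    ∀ ⦃𝒳 S : SchemeOver ℂ⦄ (f : 𝒳 ⟶ S), IsSmoothProjectiveFamily f (4 * g) →
    IsQuasiProjectiveOver 𝒳 → IsAffine S.left → IrreducibleSpace S.left →
    AlgebraicGeometry.Smooth S.hom →
    (∀ s : ComplexPoints S, ∃ (A' : AbelianVariety ℂ) (φ' : A' ⟶ A'), A'.dim = 4 * g ∧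
      Polynomial.eval₂ (Int.castRingHom (CategoryTheory.End A')) (φ' : CategoryTheory.End A') P = 0 ∧
      Nonempty (A'.X ≅ fiberOver f s)) →
    ∀ (W : complexBetti 𝒳 (2 * 2)),
    (∀ s : ComplexPoints S, IsRationalClass (complexBetti.map (fiberι f s) (2 * 2) W) ∧
      IsOfHodgeType (4 * g) (fiberOver f s) (2 * 2) 2 2 (complexBetti.map (fiberι f s) (2 * 2) W)) →
    ∀ (s₀ : ComplexPoints S),
      complexBetti.map (fiberι f s₀) (2 * 2) W ∈ algebraicClasses (fiberOver f s₀) 2 →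
    ∃ (A₁ : complexBetti 𝒳 (2 * 1)) (B : complexBetti 𝒳 (2 * 2))
      (E₀ : (fiberOver f s₀).left.Modules) (hE₀ : IsFiniteLocallyFree E₀),
      IsZeroOneSemiregular hE₀ ∧
      (∀ t : ComplexPoints S,
        IsOfHodgeType (4 * g) (fiberOver f t) (2 * 1) 1 1 (complexBetti.map (fiberι f t) (2 * 1) A₁)) ∧
      B ∈ Submodule.span ℂ {b : complexBetti 𝒳 (2 * 2) | ∃ D D' : complexBetti 𝒳 (2 * 1),
        (∀ t : ComplexPoints S,
          complexBetti.map (fiberι f t) (2 * 1) D ∈ algebraicClasses (fiberOver f t) 1 ∧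
          complexBetti.map (fiberι f t) (2 * 1) D' ∈ algebraicClasses (fiberOver f t) 1) ∧
        b = cupProduct (show 2 * 1 + 2 * 1 = 2 * 2 by norm_num) D D'} ∧
      (∀ t : ComplexPoints S,
        complexBetti.map (fiberι f t) (2 * 2) B ∈ algebraicClasses (fiberOver f t) 2) ∧
      C.ch (fiberOver f s₀) E₀ 1 = complexBetti.map (fiberι f s₀) (2 * 1) A₁ ∧
      C.ch (fiberOver f s₀) E₀ 2 =
        complexBetti.map (fiberι f s₀) (2 * 2) W + complexBetti.map (fiberι f s₀) (2 * 2) B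

/-! ## §2 The stubs (the ONLY `sorry`s of this file) -/

/-- STUB S1 (registered): abelian-fibred smooth projective families are Zariski-locally
quasi-projective, `LocallyProjective` (shared with `Lines/birth.lean`). -/
theorem stub_locallyProjective : LocallyProjective := by
  sorry

/-- STUB S2' (registered): Buchweitz–Flenner 2003, Thm. 5.1, `I = {1,2}`, as rendered by the tree's
named fact `BuchweitzFlenner2003_variationalHodge_semiregular` (a published theorem; the tree proves its
last step in `SemiregularVariationalHodge.lean`). -/
theorem stub_buchweitzFlenner : BuchweitzFlenner2003_variationalHodge_semiregular := by
  sorry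

/-- STUB S3 (registered, THE BET): semiregular seeds at the anchor, `SemiregularSeed`. -/
theorem stub_semiregularSeed : SemiregularSeed := by
  sorry

/-- Statement of STUB S4 — **A STANDARD CHERN CHARACTER THEORY EXISTS** (CONSTRUCTION, size L,
formal): an instance of the tree's hypothesis structure `StandardChernCharacterBetti` (Chern character
of algebraic vector bundles in `H²ⁱ(X(ℂ); ℂ)` with Fulton's axioms, algebraicity and span on smooth
projective varieties, and `ch₁` compatible with the real Atiyah class). The same statement, by name, as
`ChernCharacterOnBetti` of `Cruxes/WeilTenfoldsSqrtMinus11/Lines/quaternionic-norm-anchors.lean`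
(shared infrastructure debt of every sheaf-theoretic line of the summit). Why plausibly true: it is the
topological Chern character (Fulton Ch. 3 and 15, Voisin I Thm. 11.23/11.32, Atiyah 1957). -/
def ChernCharacterOnBetti : Prop :=
  Nonempty StandardChernCharacterBetti

/-- STUB S4 (registered): a standard Chern character theory exists, `ChernCharacterOnBetti`. -/
theorem stub_chernCharacter : ChernCharacterOnBetti := by
  sorry

/-! ### Name-keyed aliases (the skeleton audit admits a hypothesis of `RankFourWeilTransport_of` iff
the head constant of its type has the short name of a declared stub) -/
namespace Registered

/-- Alias of `LocallyProjective` keyed by the registered stub name. -/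
abbrev stub_locallyProjective : Prop := LocallyProjective
/-- Alias of the BF fact keyed by the registered stub name. -/
abbrev stub_buchweitzFlenner : Prop := BuchweitzFlenner2003_variationalHodge_semiregular
/-- Alias of `SemiregularSeed` keyed by the registered stub name. -/
abbrev stub_semiregularSeed : Prop := SemiregularSeed
/-- Alias of `ChernCharacterOnBetti` keyed by the registered stub name. -/
abbrev stub_chernCharacter : Prop := ChernCharacterOnBetti

end Registered

/-! ## §3 Composition (no `sorry` below this line) -/

section Glue

variable {g : ℕ} {P : Polynomial ℤ} {𝒳 S : SchemeOver ℂ}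

/-- **One step inside an S1-open, through the semiregular socket.** Granted S2' and S3: for the crux's
data over a smooth irreducible `S` and an affine open `U ⊆ S` over which `𝒳 ×_S U` is quasi-projective,
algebraicity of `W|_{𝒳_a}` passes to `W|_{𝒳_b}` whenever `pt a, pt b ∈ U`. Restrict the family to `U`
(as in birth), take the seed `(A₁, B, ℰ₀)` of S3 at the anchor `a'`, apply the tree's
`variationalHodge_conclusion_two_of_semiregular` to `A₂ := W' + B` (BF from S2', the discharged
Hilbert-scheme fact, Baire), and subtract the algebraic `B|_{𝒳_{b'}}`. -/
theorem step_of_seed (hBF : BuchweitzFlenner2003_variationalHodge_semiregular) (h₃ : SemiregularSeed)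
    (C : StandardChernCharacterBetti) (hg : 2 ≤ g) (hPm : P.Monic) (hPd : P.natDegree = 2 * g)
    (hPi : Irreducible (P.map (Int.castRingHom ℚ)))
    (hPr : ∀ ρ : ℂ, Polynomial.eval₂ (Int.castRingHom ℂ) ρ P = 0 → ρ.im ≠ 0)
    (hPc : ∃ Q : Polynomial ℚ, ∀ ρ : ℂ, Polynomial.eval₂ (Int.castRingHom ℂ) ρ P = 0 →
      Polynomial.aeval ρ Q = (starRingEnd ℂ) ρ)
    (f : 𝒳 ⟶ S) (hf : IsSmoothProjectiveFamily f (4 * g)) [IrreducibleSpace S.left]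
    [AlgebraicGeometry.Smooth S.hom]
    (hfib : ∀ s : ComplexPoints S, ∃ (A' : AbelianVariety ℂ) (φ' : A' ⟶ A'), A'.dim = 4 * g ∧
      Polynomial.eval₂ (Int.castRingHom (CategoryTheory.End A')) (φ' : CategoryTheory.End A') P = 0 ∧
      Nonempty (A'.X ≅ fiberOver f s))
    (W : complexBetti 𝒳 (2 * 2))
    (hW : ∀ s : ComplexPoints S, IsRationalClass (complexBetti.map (fiberι f s) (2 * 2) W) ∧
      IsOfHodgeType (4 * g) (fiberOver f s) (2 * 2) 2 2 (complexBetti.map (fiberι f s) (2 * 2) W))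
    (U : S.left.Opens) (hU : IsAffineOpen U)
    (hq : IsQuasiProjectiveOver (familyPullback f (openSubschemeOverι S U)))
    (a b : ComplexPoints S) (haU : a.pt ∈ U) (hbU : b.pt ∈ U)
    (ha : complexBetti.map (fiberι f a) (2 * 2) W ∈ algebraicClasses (fiberOver f a) 2) :
    complexBetti.map (fiberι f b) (2 * 2) W ∈ algebraicClasses (fiberOver f b) 2 := by
  -- the affine open `U` as a smooth irreducible affine (hence quasi-projective) `ℂ`-scheme
  haveI : IsOpenImmersion (openSubschemeOverι S U).left := inferInstanceAs (IsOpenImmersion U.ι)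
  haveI hUaff : IsAffine (openSubschemeOver S U).left := hU
  haveI hUirr : IrreducibleSpace (openSubschemeOver S U).left := by
    change IrreducibleSpace U
    exact isIrreducible_iff_irreducibleSpace.mp ⟨⟨a.pt, haU⟩,
      (PreirreducibleSpace.isPreirreducible_univ (X := S.left)).open_subset U.isOpen
        (Set.subset_univ _)⟩
  haveI hUsm : AlgebraicGeometry.Smooth (openSubschemeOver S U).hom := by
    change AlgebraicGeometry.Smooth (U.ι ≫ S.hom)
    infer_instance
  haveI : LocallyOfFiniteType (openSubschemeOver S U).hom := by
    change LocallyOfFiniteType (U.ι ≫ S.hom)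
    infer_instance
  have hUqp : IsQuasiProjectiveOver (openSubschemeOver S U) := IsQuasiProjectiveOver.of_isAffine _
  -- the base `U` is smooth of some relative dimension `d` (`U(ℂ)` is connected: SGA1 XII 2.4)
  haveI : ConnectedSpace (ComplexPoints (openSubschemeOver S U)) :=
    (ComplexPoints.connectedSpace_iff_holds (openSubschemeOver S U)).2 inferInstance
  obtain ⟨d, hd⟩ := exists_smoothOfRelativeDimension_of_connectedSpace_complexPoints
    (openSubschemeOver S U)
  haveI := hd
  -- lift `a`, `b` to `U`
  have hrange : Set.range (AlgPoints.map (L := ℂ) (openSubschemeOverι S U)) = {Q | Q.pt ∈ U} := by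
    rw [AlgPoints.range_map_of_isOpenImmersion_holds]
    ext Q
    change Q.pt ∈ U.ι.opensRange ↔ Q.pt ∈ U
    rw [Scheme.Opens.opensRange_ι]
  obtain ⟨a', rfl⟩ : a ∈ Set.range (AlgPoints.map (L := ℂ) (openSubschemeOverι S U)) := by
    rw [hrange]; exact haU
  obtain ⟨b', rfl⟩ : b ∈ Set.range (AlgPoints.map (L := ℂ) (openSubschemeOverι S U)) := by
    rw [hrange]; exact hbU
  -- the restricted family `f' : 𝒳 ×_S U ⟶ U` and its data
  set f' := familyPullback.snd f (openSubschemeOverι S U) with hf'def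
  have hf' : IsSmoothProjectiveFamily f' (4 * g) := hf.familyPullback_snd _
  have hfib' : ∀ s' : ComplexPoints (openSubschemeOver S U), ∃ (A' : AbelianVariety ℂ) (φ' : A' ⟶ A'),
      A'.dim = 4 * g ∧
      Polynomial.eval₂ (Int.castRingHom (CategoryTheory.End A')) (φ' : CategoryTheory.End A') P = 0 ∧
      Nonempty (A'.X ≅ fiberOver f' s') := by
    intro s'
    obtain ⟨A', φ', hdim, hP, ⟨e⟩⟩ := hfib (AlgPoints.map (openSubschemeOverι S U) s')
    exact ⟨A', φ', hdim, hP, ⟨e ≪≫ (fiberOverFamilyPullbackIso f (openSubschemeOverι S U) s').symm⟩⟩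
  set W' : complexBetti (familyPullback f (openSubschemeOverι S U)) (2 * 2) :=
    complexBetti.map (familyPullback.fst f (openSubschemeOverι S U)) (2 * 2) W with hW'def
  have hW' : ∀ s' : ComplexPoints (openSubschemeOver S U),
      IsRationalClass (complexBetti.map (fiberι f' s') (2 * 2) W') ∧
      IsOfHodgeType (4 * g) (fiberOver f' s') (2 * 2) 2 2 (complexBetti.map (fiberι f' s') (2 * 2) W') :=
    fun s' => familyPullback_fibrewise_rational_hodgeType (n := 4 * g) (p := 2) f
      (openSubschemeOverι S U) W hW s'
  have ha' : complexBetti.map (fiberι f' a') (2 * 2) W' ∈ algebraicClasses (fiberOver f' a') 2 :=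
    (map_fiberι_familyPullback_mem_algebraicClasses_iff (p := 2) f (openSubschemeOverι S U) hf W a').2 ha
  -- S3 on `U`: the semiregular seed at the anchor `a'`
  obtain ⟨A₁, B, E₀, hE₀, hsr, hA₁, -, hBalg, h₁, h₂⟩ := h₃ C g hg P hPm hPd hPi hPr hPc f' hf' hq hUaff
    hUirr hUsm hfib' W' hW' a' ha'
  -- `A₂ := W' + B` has fibre restrictions of type `(2,2)` (algebraic classes are of Hodge type)
  have hA₂ : ∀ t : ComplexPoints (openSubschemeOver S U), IsOfHodgeType (4 * g) (fiberOver f' t) (2 * 2) 2 2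
      (complexBetti.map (fiberι f' t) (2 * 2) (W' + B)) := by
    intro t
    rw [map_add]
    exact (hW' t).2.add (hf'.isSmoothProjective t)
      (isOfHodgeType_of_mem_algebraicClasses_of_isSmoothProjective (hf'.isSmoothProjective t) 2 (hBalg t))
  have h₂' : C.ch (fiberOver f' a') E₀ 2 = complexBetti.map (fiberι f' a') (2 * 2) (W' + B) := by
    rw [map_add]; exact h₂
  -- Buchweitz–Flenner at the semiregular anchor, globalised by the tree (Baire + Hilbert schemes)
  have hb' : complexBetti.map (fiberι f' b') (2 * 2) (W' + B) ∈ algebraicClasses (fiberOver f' b') 2 :=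
    variationalHodge_conclusion_two_of_semiregular (d := d) f' hBF
      charlesSchnell_algebraicityLocus_iUnion_closed_holds C.toChernCharacterBetti hf' hq hUqp hUsm hUirr
      A₁ (W' + B) hA₁ hA₂ a' E₀ hE₀ hsr h₁ h₂' b'
  -- subtract the algebraic correction `B|_{𝒳_{b'}}` and move back to `S`
  have hWb' : complexBetti.map (fiberι f' b') (2 * 2) W' ∈ algebraicClasses (fiberOver f' b') 2 := by
    have h := Submodule.sub_mem _ hb' (hBalg b')
    rwa [map_add, add_sub_cancel_right] at h
  exact (map_fiberι_familyPullback_mem_algebraicClasses_iff (p := 2) f (openSubschemeOverι S U) hf W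
    b').1 hWb'

end Glue

/-- **The four stubs imply the crux, BY NAME.** Given the crux's data, S1 supplies affine opens
`U₀ ∋ pt s₀`, `U ∋ pt s` over which the total space is quasi-projective; they meet (irreducibility of
`S`) in a Zariski open carrying a complex point `u` (`S` is Jacobson); `step_of_seed` (S2' + S3 + the
Chern character theory of S4 + the tree's locus theorem + Baire) moves algebraicity `s₀ → u` inside `U₀`
and `u → s` inside `U`. -/
theorem RankFourWeilTransport_of (h₁ : Registered.stub_locallyProjective)
    (h₂ : Registered.stub_buchweitzFlenner) (h₃ : Registered.stub_semiregularSeed)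
    (h₄ : Registered.stub_chernCharacter) :
    Summit.HodgeConjecture.HodgeConjecture.Theses.RankFourFaces.RankFourWeilTransport := by
  intro g hg P hPm hPd hPi hPr hPc 𝒳 S f hf hirr hsm hfib W hW hs₀ s
  obtain ⟨s₀, hs₀⟩ := hs₀
  obtain ⟨C⟩ := h₄
  haveI := hirr
  haveI := hsm
  -- the fibres are abelian varieties (forget the `E`-structure for S1)
  have hab : ∀ t : ComplexPoints S, ∃ A' : AbelianVariety ℂ, Nonempty (A'.X ≅ fiberOver f t) :=
    fun t => by
      obtain ⟨A', -, -, -, hA'⟩ := hfib t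
      exact ⟨A', hA'⟩
  -- S1: affine opens through `pt s₀` and `pt s` with quasi-projective total space above them
  obtain ⟨U₀, hU₀, hs₀U₀, hq₀⟩ := h₁ (4 * g) f hf hsm hab s₀
  obtain ⟨U, hU, hsU, hq⟩ := h₁ (4 * g) f hf hsm hab s
  -- a complex point over `U₀ ∩ U` (irreducible + Jacobson)
  have hne : ((U₀ : Set S.left) ∩ (U : Set S.left)).Nonempty := by
    obtain ⟨x, -, hx⟩ := (PreirreducibleSpace.isPreirreducible_univ (X := S.left)) _ _ U₀.isOpen
      U.isOpen ⟨s₀.pt, Set.mem_univ _, hs₀U₀⟩ ⟨s.pt, Set.mem_univ _, hsU⟩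
    exact ⟨x, hx⟩
  obtain ⟨u, huU₀, huU⟩ := exists_complexPoints_pt_mem_of_isOpen (S := S) (U₀.isOpen.inter U.isOpen)
    hne
  -- `s₀ → u` inside `U₀`, then `u → s` inside `U`
  exact step_of_seed h₂ h₃ C hg hPm hPd hPi hPr hPc f hf hfib W hW U hU hq u s huU hsU
    (step_of_seed h₂ h₃ C hg hPm hPd hPi hPr hPc f hf hfib W hW U₀ hU₀ hq₀ s₀ u hs₀U₀ huU₀ hs₀)

/-- Wiring check: the registered stubs feed the composition as stated (definitional unfolding only). -/
example : Summit.HodgeConjecture.HodgeConjecture.Theses.RankFourFaces.RankFourWeilTransport :=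
  RankFourWeilTransport_of stub_locallyProjective stub_buchweitzFlenner stub_semiregularSeed
    stub_chernCharacter

/-! ## §4 Plumbing sanity (proved): the DEGENERATE seed. When the anchor class is already the
restriction of a decomposable-and-fibrewise-algebraic global class `B₀` — the case in which nothing is
to be proved — S3 holds with `ℰ₀` any `{0,1}`-semiregular bundle with vanishing `ch₁`, `ch₂` (e.g. the
structure sheaf, granted its semiregularity), `A₁ = 0`, `B = -B₀`: recorded to show where the
decomposability clause bites (an EXCEPTIONAL `W` admits no such `B₀`). Stated for a given bundle so as
to assume nothing about `𝒪`. -/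
example {g : ℕ} {𝒳 S : SchemeOver ℂ} (f : 𝒳 ⟶ S) (hf : IsSmoothProjectiveFamily f (4 * g))
    (C : StandardChernCharacterBetti) (W B₀ : complexBetti 𝒳 (2 * 2)) (s₀ : ComplexPoints S)
    (hWB : complexBetti.map (fiberι f s₀) (2 * 2) W = complexBetti.map (fiberι f s₀) (2 * 2) B₀)
    (E₀ : (fiberOver f s₀).left.Modules) (hE₀ : IsFiniteLocallyFree E₀) (hsr : IsZeroOneSemiregular hE₀)
    (h₁ : C.ch (fiberOver f s₀) E₀ 1 = 0) (h₂ : C.ch (fiberOver f s₀) E₀ 2 = 0) :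
    ∃ (A₁ : complexBetti 𝒳 (2 * 1)) (B : complexBetti 𝒳 (2 * 2))
      (E₀ : (fiberOver f s₀).left.Modules) (hE₀ : IsFiniteLocallyFree E₀),
      IsZeroOneSemiregular hE₀ ∧
      (∀ t : ComplexPoints S,
        IsOfHodgeType (4 * g) (fiberOver f t) (2 * 1) 1 1 (complexBetti.map (fiberι f t) (2 * 1) A₁)) ∧
      C.ch (fiberOver f s₀) E₀ 1 = complexBetti.map (fiberι f s₀) (2 * 1) A₁ ∧
      C.ch (fiberOver f s₀) E₀ 2 =
        complexBetti.map (fiberι f s₀) (2 * 2) W + complexBetti.map (fiberι f s₀) (2 * 2) B := by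
  refine ⟨0, -B₀, E₀, hE₀, hsr, fun t => ?_, by rw [map_zero]; exact h₁, ?_⟩
  · rw [map_zero]
    obtain ⟨A⟩ := (nonempty_hodgeModel_holds (n := 4 * g) (X := fiberOver f t)).nonempty
      (hf.isSmoothProjective t)
    exact IsOfHodgeType.zero A _ _ _
  · rw [map_neg, hWB, add_neg_cancel]; exact h₂

end Summit.HodgeConjecture.HodgeConjecture.Cruxes.RankFourWeilTransport.SrSocket

end
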